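import Summits.SmoothPoincare4.SmoothPoincare4.Theorems.SullivanDualWitnessChargeCapDefs
import Summits.SmoothPoincare4.SmoothPoincare4.Theorems.SullivanDualWitnessChargeV15InterceptChartAux1
import Summits.SmoothPoincare4.SmoothPoincare4.Theorems.SullivanDualWitnessChargeV15InterceptChartAux2

/-!
# Stub S5 `stub_interceptChart` of skeleton v15 — the intercept chart of a local family through
the compactified member (crux `WitnessCharge`, stmt-SmoothPoincare4-7824, line `Sketch`, lead c8)

In the cap model `X = (Σ ∖ p) ∪ {‖t‖ < ρ} × ℂ_σ` (`CapData`), let `(U a, V a)`, `‖a‖ < ε`, be a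
jointly smooth family of `JX`-holomorphic two-chart spheres through the compactified member
`(sphereU u₀ lam, sphereV u₀ b₀ lam)` (`lam` an admissible scale) with jointly immersive evaluation
maps. Near `a = 0` we build the INTERCEPT CHART:

* domains by compactness and joint continuity: for `‖a‖ < ε₁` the `V`-disc `‖w‖ ≤ 1/2` stays in the
  cap chart domain `capInv {‖t‖ < ρ}` and the `U`-disc `‖z‖ ≤ 2`, as well as the `V`-annulus
  `r₁ ≤ ‖w‖ ≤ 1/2`, stay in `ι(Σ ∖ p)` (so off the added line `E = capPt(ℂ)`);
* holomorphy: `w ↦ capCoord (V a w)` is complex differentiable on `‖w‖ < 1/2`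
  (`helper_interceptChart_capHolo`: `JX = i` in the cap chart);
* the simple zero: along `V 0`, `t = (capCoord (V 0 w)).1 = 1 / z(u₀(lam / w))` has derivative
  `lam⁻¹ ≠ 0` at `w = 0` (`helper_interceptChart_slope`, from the admissibility estimate
  `‖z(u₀ ξ) − ξ‖ ≤ 1`);
* the inverse function theorem, twice (`helper_interceptChart_localDiffeo`) applied to
  `G (a, w) = capCoord (V a w)` (its derivative at `(0, 0)` is injective — immersive family composed
  with the cap chart — hence invertible): the zero `wz a` of `t` along `V a`, the intercept `β a`
  with `V a (wz a) = capPt (β a)`, its local inverse `α` on `ball b₀ δ`, and the local uniqueness of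
  the zero on `‖w‖ < r₁`.
-/

noncomputable section

set_option linter.dupNamespace false

open scoped Manifold ContDiff Topology
open Set Filter Literature.Geometry.Symplectic Literature.Topology.FourManifolds

namespace Summit.SmoothPoincare4.SmoothPoincare4.Theorems.WitnessCharge.PencilIncompleteness

/-- A one-sided inverse `B` of a bijective continuous linear map `A` (`B ∘ A = id`) is bijective. -/
private theorem interceptChart_bijective_of_comp_eq_id {E F : Type*} [TopologicalSpace E]
    [AddCommMonoid E] [Module ℝ E] [TopologicalSpace F] [AddCommMonoid F] [Module ℝ F]
    {A : E →L[ℝ] F} {B : F →L[ℝ] E}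
    (h : B.comp A = ContinuousLinearMap.id ℝ E) (hA : Function.Bijective A) :
    Function.Bijective B := by
  have hBA : ∀ v, B (A v) = v := fun v => ContinuousLinearMap.ext_iff.1 h v
  refine ⟨fun u u' huu' => ?_, fun v => ⟨A v, hBA v⟩⟩
  obtain ⟨v, rfl⟩ := hA.2 u
  obtain ⟨v', rfl⟩ := hA.2 u'
  rw [hBA, hBA] at huu'
  rw [huu']

/-- At an admissible scale, for `0 < ‖w‖ ≤ 2` the parameter `ξ = lam / w` has `‖ξ‖ ≥ lam / 2`. -/
private theorem interceptChart_norm_param {lam : ℝ} (hlam : 4 ≤ lam) {w : ℂ} (hw : w ≠ 0)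
    (hw2 : ‖w‖ ≤ 2) : lam / 2 ≤ ‖(lam : ℂ) * w⁻¹‖ := by
  have hwpos : 0 < ‖w‖ := norm_pos_iff.2 hw
  rw [norm_mul, norm_inv, Complex.norm_real, Real.norm_eq_abs, abs_of_nonneg (by linarith),
    ← div_eq_mul_inv]
  exact div_le_div_of_nonneg_left (by linarith) hwpos hw2

/-- **Stub S5 — the intercept chart of a local family through the compactified member.** For a
jointly smooth family `(U a, V a)`, `‖a‖ < ε`, of `JX`-holomorphic two-chart spheres through
`(sphereU u₀ lam, sphereV u₀ b₀ lam)` with jointly immersive evaluation maps (existence half of the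
HLS fact), near `a = 0`: the `V`-disc `‖w‖ < 1/2` lies in the cap chart, where `w ↦ capCoord (V a w)`
is holomorphic (`JX = i` there); its `t`-component has exactly one zero `wz a` on `‖w‖ ≤ 1/2`, simple
(IFT + `C¹`-closeness to `a = 0`, where `t = w/lam + O(w²)`), i.e. the leaf meets the added line
`E` once on that disc and not on the `U`-disc `‖z‖ ≤ 2`; the intercept `β a = σ(V a (wz a))` is a
local diffeomorphism at `0` (the evaluation map `(a, w) ↦ V a w` is a local diffeomorphism at
`(0, 0)` carrying the graph of `wz` onto `E`), with local inverse `α` on `ball b₀ δ`. -/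
theorem stub_interceptChart :
    ∀ (S : HomotopySphere 4) (p : S.carrier)
      (J : ∀ x : punctured p, TangentSpace (𝓡 4) x →L[ℝ] TangentSpace (𝓡 4) x) (ε' : ℝ)
      (hε' : 0 < ε')
      (hball : Metric.closedBall (extChartAt (𝓡 4) p p) ε' ⊆ (extChartAt (𝓡 4) p).target),
      (∀ (x : punctured p) (v : TangentSpace (𝓡 4) x), J x (J x v) = -v) →
      (∀ x₀ : punctured p, ContMDiffAt (𝓡 4) 𝓘(ℝ, EuclideanSpace ℝ (Fin 4) →L[ℝ] EuclideanSpace ℝ (Fin 4)) ∞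
        (inTangentCoordinates (𝓡 4) (𝓡 4) (id : punctured p → punctured p) id (fun x => J x) x₀) x₀) →
      (∀ x : punctured p, InPuncturedChartBall p ε' x →
        ∀ (v : TangentSpace (𝓡 4) x) (b : EuclideanSpace ℝ (Fin 4)),
          inner ℝ (fderiv ℝ inversion (extChartAt (𝓡 4) p x.1 - extChartAt (𝓡 4) p p)
            (mfderiv (𝓡 4) 𝓘(ℝ, EuclideanSpace ℝ (Fin 4))
              (fun z : punctured p => extChartAt (𝓡 4) p z.1) x (J x v))) b
          = stdSymplecticForm (fderiv ℝ inversion (extChartAt (𝓡 4) p x.1 - extChartAt (𝓡 4) p p)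
            (mfderiv (𝓡 4) 𝓘(ℝ, EuclideanSpace ℝ (Fin 4))
              (fun z : punctured p => extChartAt (𝓡 4) p z.1) x v)) b) →
      ∀ (D : CapData S p J ε') (u₀ : ℂ → punctured p) (b₀ : ℂ) (lam : ℝ),
      IsPencilMember J u₀ b₀ → D.AdmissibleScale u₀ lam →
      ∀ (ε : ℝ) (U V : ℂ → ℂ → D.X), 0 < ε →
      (∀ z, U 0 z = D.sphereU u₀ lam z) → (∀ w, V 0 w = D.sphereV u₀ b₀ lam w) →
      (∀ a : ℂ, ‖a‖ < ε →
        (∀ z : ℂ, z ≠ 0 → V a z = U a z⁻¹) ∧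
        IsJHolomorphic (𝓡 4) (fun y => D.JX y) (U a) ∧ IsJHolomorphic (𝓡 4) (fun y => D.JX y) (V a)) →
      ContMDiffOn 𝓘(ℝ, ℂ × ℂ) (𝓡 4) ∞ (fun q : ℂ × ℂ => U q.1 q.2) (Metric.ball 0 ε ×ˢ univ) →
      ContMDiffOn 𝓘(ℝ, ℂ × ℂ) (𝓡 4) ∞ (fun q : ℂ × ℂ => V q.1 q.2) (Metric.ball 0 ε ×ˢ univ) →
      (∀ q ∈ Metric.ball (0 : ℂ) ε ×ˢ (univ : Set ℂ),
        Function.Injective (mfderiv 𝓘(ℝ, ℂ × ℂ) (𝓡 4) (fun q : ℂ × ℂ => U q.1 q.2) q) ∧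
        Function.Injective (mfderiv 𝓘(ℝ, ℂ × ℂ) (𝓡 4) (fun q : ℂ × ℂ => V q.1 q.2) q)) →
      ∃ (ε₁ r₁ δ : ℝ) (wz α β : ℂ → ℂ), 0 < ε₁ ∧
        ε₁ ≤ ε ∧
        0 < r₁ ∧
        r₁ ≤ 4⁻¹ ∧
        0 < δ ∧
        ContDiffOn ℝ ∞ wz (Metric.ball 0 ε₁) ∧
        wz 0 = 0 ∧
        (∀ a ∈ Metric.ball (0 : ℂ) ε₁, ‖wz a‖ < r₁) ∧
        (∀ a ∈ Metric.ball (0 : ℂ) ε₁, ∀ w : ℂ, ‖w‖ < 2⁻¹ →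
          V a w ∈ D.capInv '' {q : ℂ × ℂ | ‖q.1‖ < D.ρ}) ∧
        (∀ a ∈ Metric.ball (0 : ℂ) ε₁, ∀ w : ℂ, ‖w‖ ≤ 2⁻¹ → (V a w ∈ range D.capPt ↔ w = wz a)) ∧
        (∀ a ∈ Metric.ball (0 : ℂ) ε₁, ∀ z : ℂ, ‖z‖ ≤ 2 → U a z ∈ range D.ι) ∧
        (∀ a ∈ Metric.ball (0 : ℂ) ε₁, DifferentiableOn ℂ (fun w => D.capCoord (V a w)) (Metric.ball 0 2⁻¹)) ∧
        (∀ a ∈ Metric.ball (0 : ℂ) ε₁, deriv (fun w => (D.capCoord (V a w)).1) (wz a) ≠ 0) ∧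
        (∀ a ∈ Metric.ball (0 : ℂ) ε₁, V a (wz a) = D.capPt (β a)) ∧
        (∀ a ∈ Metric.ball (0 : ℂ) ε₁, β a = (D.capCoord (V a (wz a))).2) ∧
        ContDiffOn ℝ ∞ β (Metric.ball 0 ε₁) ∧
        β 0 = b₀ ∧
        ContDiffOn ℝ ∞ α (Metric.ball b₀ δ) ∧
        α b₀ = 0 ∧
        (∀ b ∈ Metric.ball b₀ δ, α b ∈ Metric.ball (0 : ℂ) ε₁ ∧ β (α b) = b) ∧
        (∀ a ∈ Metric.ball (0 : ℂ) ε₁, β a ∈ Metric.ball b₀ δ → α (β a) = a) ∧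
        (∀ b ∈ Metric.ball b₀ δ, Function.Bijective (fderiv ℝ α b)) := by
  intro S p J ε' _ _ _ _ _ D u₀ b₀ lam _ hadm ε U V hε hU0 hV0 hUV hUfam hVfam hinj
  have hn : (∞ : WithTop ℕ∞) ≠ 0 := by simp
  obtain ⟨hlam4, hadm'⟩ := (D.admissibleScale_iff u₀ lam).1 hadm
  have hlam0 : (lam : ℂ) ≠ 0 := by exact_mod_cast (by linarith : lam ≠ 0)
  have hρ0 : ‖((0 : ℂ), b₀).1‖ < D.ρ := by simpa using D.ρ_pos
  -- the cap chart domain and the evaluation maps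
  set capDom : Set D.X := D.capInv '' {q : ℂ × ℂ | ‖q.1‖ < D.ρ} with hcapDom
  set Vf : ℂ × ℂ → D.X := fun q => V q.1 q.2 with hVf
  set Uf : ℂ × ℂ → D.X := fun q => U q.1 q.2 with hUf
  have hdomo : IsOpen (Metric.ball (0 : ℂ) ε ×ˢ (univ : Set ℂ)) := Metric.isOpen_ball.prod isOpen_univ
  have h0dom : ∀ w : ℂ, ((0 : ℂ), w) ∈ Metric.ball (0 : ℂ) ε ×ˢ (univ : Set ℂ) :=
    fun w => ⟨Metric.mem_ball_self hε, mem_univ _⟩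
  -- the central sphere: values of `V 0`, `U 0`
  have hV00 : V 0 0 = D.capInv (0, b₀) := by rw [hV0, D.sphereV_zero, D.capInv_zero]
  have hV0w : ∀ w : ℂ, w ≠ 0 → ‖w‖ ≤ 2 →
      V 0 w = D.capInv (((Ycoord p (u₀ ((lam : ℂ) * w⁻¹))).1)⁻¹,
        (Ycoord p (u₀ ((lam : ℂ) * w⁻¹))).2) ∧
      ‖((Ycoord p (u₀ ((lam : ℂ) * w⁻¹))).1)⁻¹‖ < D.ρ := by
    intro w hw hw2
    obtain ⟨hin, hgt, -⟩ := hadm' _ (interceptChart_norm_param hlam4 hw hw2)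
    have hgt' : D.ρ⁻¹ < ‖(Ycoord p (u₀ ((lam : ℂ) * w⁻¹))).1‖ := by linarith
    refine ⟨?_, ?_⟩
    · rw [hV0, D.sphereV_apply_of_ne _ _ _ hw, D.capInv_Ycoord _ hin hgt']
    · rw [norm_inv]
      have hpos : 0 < ‖(Ycoord p (u₀ ((lam : ℂ) * w⁻¹))).1‖ := (inv_pos.2 D.ρ_pos).trans hgt'
      exact (inv_lt_comm₀ hpos D.ρ_pos).2 hgt'
  have hV0dom : ∀ w : ℂ, ‖w‖ ≤ 2 → V 0 w ∈ capDom := by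
    intro w hw2
    by_cases hw : w = 0
    · rw [hw, hV00]
      exact ⟨_, hρ0, rfl⟩
    · obtain ⟨h1, h2⟩ := hV0w w hw hw2
      exact ⟨_, h2, h1.symm⟩
  have hV0ι : ∀ w : ℂ, w ≠ 0 → V 0 w ∈ range D.ι := by
    intro w hw
    rw [hV0, D.sphereV_apply_of_ne _ _ _ hw]
    exact ⟨_, rfl⟩
  have hU0ι : ∀ z : ℂ, U 0 z ∈ range D.ι := fun z => by
    rw [hU0, D.sphereU_apply]
    exact ⟨_, rfl⟩
  -- the leaves read in the cap chart: `G (a, w) = capCoord (V a w)` on `O`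
  set O : Set (ℂ × ℂ) := (Metric.ball (0 : ℂ) ε ×ˢ (univ : Set ℂ)) ∩ Vf ⁻¹' capDom with hO
  have hOo : IsOpen O := hVfam.continuousOn.isOpen_inter_preimage hdomo D.isOpen_capDom
  have hOdom : ∀ q ∈ O, Vf q ∈ capDom := fun q hq => hq.2
  have h0O : ((0 : ℂ), (0 : ℂ)) ∈ O := ⟨h0dom 0, hV0dom 0 (by simp)⟩
  set G : ℂ × ℂ → ℂ × ℂ := fun q => D.capCoord (Vf q) with hG
  have hGs : ContDiffOn ℝ ∞ G O :=
    contMDiffOn_iff_contDiffOn.1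
      (D.contMDiffOn_capCoord.comp (hVfam.mono inter_subset_left) fun q hq => hq.2)
  have hG0 : G (0, 0) = (0, b₀) := by
    change D.capCoord (V 0 0) = (0, b₀)
    rw [hV00, D.capCoord_capInv _ hρ0]
  -- `DG (0, 0)` is injective (immersive family, cap chart), hence bijective
  have hbijG : Function.Bijective (fderiv ℝ G (0, 0)) := by
    have hVd : MDifferentiableAt 𝓘(ℝ, ℂ × ℂ) (𝓡 4) Vf (0, 0) :=
      (hVfam.contMDiffAt (hdomo.mem_nhds (h0dom 0))).mdifferentiableAt hn
    have hcd : MDifferentiableAt (𝓡 4) 𝓘(ℝ, ℂ × ℂ) D.capCoord (Vf (0, 0)) :=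
      (D.contMDiffOn_capCoord.contMDiffAt (D.isOpen_capDom.mem_nhds (hOdom _ h0O))).mdifferentiableAt
        hn
    have hchain : mfderiv 𝓘(ℝ, ℂ × ℂ) 𝓘(ℝ, ℂ × ℂ) G (0, 0) =
        (mfderiv (𝓡 4) 𝓘(ℝ, ℂ × ℂ) D.capCoord (Vf (0, 0))).comp
          (mfderiv 𝓘(ℝ, ℂ × ℂ) (𝓡 4) Vf (0, 0)) :=
      mfderiv_comp _ hcd hVd
    have hbijC : Function.Bijective (mfderiv (𝓡 4) 𝓘(ℝ, ℂ × ℂ) D.capCoord (Vf (0, 0))) := by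
      have e : Vf (0, 0) = D.capInv (0, b₀) := hV00
      rw [e]
      exact interceptChart_bijective_of_comp_eq_id (D.mfderiv_capCoord_comp _ hρ0)
        (D.mfderiv_capInv_bijective _ hρ0)
    have hinjG : Function.Injective (fderiv ℝ G (0, 0)) := by
      rw [← mfderiv_eq_fderiv, hchain]
      exact hbijC.1.comp (hinj (0, 0) (h0dom 0)).2
    exact ⟨hinjG, (LinearMap.injective_iff_surjective
      (f := ((fderiv ℝ G (0, 0) : (ℂ × ℂ) →L[ℝ] ℂ × ℂ) : (ℂ × ℂ) →ₗ[ℝ] ℂ × ℂ))).1 hinjG⟩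
  -- the simple zero of `t` along `V 0`
  have hc : HasDerivAt (fun w : ℂ => (G (0, w)).1) ((lam : ℂ)⁻¹) 0 := by
    refine helper_interceptChart_slope (fun w => (G (0, w)).1) (fun ξ => (Ycoord p (u₀ ξ)).1) lam
      hlam4 ?_ ?_ fun ξ hξ => (hadm' ξ hξ).2.2
    · change (D.capCoord (V 0 0)).1 = 0
      rw [hV00, D.capCoord_capInv _ hρ0]
    · intro w hw hw1
      change (D.capCoord (V 0 w)).1 = _
      obtain ⟨h1, h2⟩ := hV0w w hw (by linarith [hw1.le])
      rw [h1, D.capCoord_capInv _ h2]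
  -- the flat inverse-function-theorem package
  obtain ⟨T, A, wz, α, β, hTo, h0T, hAo, hb₀A, hwzs, hwz0, hβs, hβ0, hαs, hαb₀, hβα, hαβ, hdα,
      hGwz, hDne, r, hr, huniq⟩ :=
    helper_interceptChart_localDiffeo G O b₀ _ hOo h0O hGs hG0 hbijG hc (inv_ne_zero hlam0)
  set r₁ : ℝ := min r 4⁻¹ with hr₁
  have hr₁pos : 0 < r₁ := lt_min hr (by norm_num)
  have hr₁r : r₁ ≤ r := min_le_left _ _
  -- everything holds for `a` near `0`
  have hE1 : ∀ᶠ a in 𝓝 (0 : ℂ), a ∈ T := hTo.mem_nhds h0T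
  have hE2 : ∀ᶠ a in 𝓝 (0 : ℂ), ‖wz a‖ < r₁ := by
    have hwc : ContinuousAt wz 0 := hwzs.continuousOn.continuousAt (hTo.mem_nhds h0T)
    have h : ∀ᶠ a in 𝓝 (0 : ℂ), wz a ∈ Metric.ball (0 : ℂ) r₁ :=
      hwc.preimage_mem_nhds (by rw [hwz0]; exact Metric.ball_mem_nhds 0 hr₁pos)
    filter_upwards [h] with a ha
    exact mem_ball_zero_iff.1 ha
  have hE3 : ∀ᶠ a in 𝓝 (0 : ℂ), ∀ w ∈ Metric.closedBall (0 : ℂ) 2⁻¹, (a, w) ∈ O := by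
    apply (isCompact_closedBall (0 : ℂ) 2⁻¹).eventually_forall_of_forall_eventually
    intro w hw
    have hw2 : ‖w‖ ≤ 2 := by linarith [mem_closedBall_zero_iff.1 hw]
    exact hOo.mem_nhds ⟨h0dom w, hV0dom w hw2⟩
  have hE4 : ∀ᶠ a in 𝓝 (0 : ℂ), ∀ w ∈ Metric.closedBall (0 : ℂ) 2⁻¹ \ Metric.ball 0 r₁,
      Vf (a, w) ∈ range D.ι := by
    apply ((isCompact_closedBall (0 : ℂ) 2⁻¹).diff Metric.isOpen_ball).eventually_forall_of_forall_eventually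
    intro w hw
    have hw0 : w ≠ 0 := by
      rintro rfl
      exact hw.2 (Metric.mem_ball_self hr₁pos)
    have hcont : ContinuousAt Vf (0, w) := hVfam.continuousOn.continuousAt (hdomo.mem_nhds (h0dom w))
    exact hcont.preimage_mem_nhds (D.isOpenEmbedding_ι.isOpen_range.mem_nhds (hV0ι w hw0))
  have hE5 : ∀ᶠ a in 𝓝 (0 : ℂ), ∀ z ∈ Metric.closedBall (0 : ℂ) 2, Uf (a, z) ∈ range D.ι := by
    apply (isCompact_closedBall (0 : ℂ) 2).eventually_forall_of_forall_eventually
    intro z _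
    have hcont : ContinuousAt Uf (0, z) := hUfam.continuousOn.continuousAt (hdomo.mem_nhds (h0dom z))
    exact hcont.preimage_mem_nhds (D.isOpenEmbedding_ι.isOpen_range.mem_nhds (hU0ι z))
  have hE6 : ∀ᶠ a in 𝓝 (0 : ℂ), a ∈ Metric.ball (0 : ℂ) ε := Metric.ball_mem_nhds 0 hε
  obtain ⟨ε₀, hε₀, hall⟩ := Metric.eventually_nhds_iff.1
    (hE1.and (hE2.and (hE3.and (hE4.and (hE5.and (hE6.and (hDne.and huniq)))))))
  set ε₁ : ℝ := min ε₀ ε with hε₁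
  have hε₁pos : 0 < ε₁ := lt_min hε₀ hε
  have key : ∀ a ∈ Metric.ball (0 : ℂ) ε₁, a ∈ T ∧ ‖wz a‖ < r₁ ∧
      (∀ w ∈ Metric.closedBall (0 : ℂ) 2⁻¹, (a, w) ∈ O) ∧
      (∀ w ∈ Metric.closedBall (0 : ℂ) 2⁻¹ \ Metric.ball 0 r₁, Vf (a, w) ∈ range D.ι) ∧
      (∀ z ∈ Metric.closedBall (0 : ℂ) 2, Uf (a, z) ∈ range D.ι) ∧ a ∈ Metric.ball (0 : ℂ) ε ∧
      fderiv ℝ (fun w : ℂ => (G (a, w)).1) (wz a) 1 ≠ 0 ∧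
      (∀ w : ℂ, ‖w‖ < r → (a, w) ∈ O ∧ ((G (a, w)).1 = 0 → w = wz a)) :=
    fun a ha => hall ((Metric.mem_ball.1 ha).trans_le (min_le_left _ _))
  -- the leaf `a` meets `E` at `w = wz a`, at the point `capPt (β a)`
  have hhit : ∀ a ∈ Metric.ball (0 : ℂ) ε₁,
      V a (wz a) = D.capPt (β a) ∧ D.capCoord (V a (wz a)) = (0, β a) := by
    intro a ha
    obtain ⟨hO', hG'⟩ := hGwz a (key a ha).1
    obtain ⟨q, hq, hqV⟩ := hOdom _ hO'
    change D.capInv q = V a (wz a) at hqV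
    change D.capCoord (V a (wz a)) = (0, β a) at hG'
    refine ⟨?_, hG'⟩
    rw [← hqV, D.capCoord_capInv q hq] at hG'
    rw [← hqV, hG', D.capInv_zero]
  -- `δ`: `α` maps `ball b₀ δ` into `ball 0 ε₁`
  have hαc : ContinuousAt α b₀ := hαs.continuousOn.continuousAt (hAo.mem_nhds hb₀A)
  obtain ⟨δ, hδ, hδsub⟩ : ∃ δ > 0, Metric.ball b₀ δ ⊆ A ∩ α ⁻¹' Metric.ball (0 : ℂ) ε₁ :=
    Metric.mem_nhds_iff.1 (inter_mem (hAo.mem_nhds hb₀A)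
      (hαc.preimage_mem_nhds (by rw [hαb₀]; exact Metric.ball_mem_nhds 0 hε₁pos)))
  refine ⟨ε₁, r₁, δ, wz, α, β, hε₁pos, min_le_right _ _, hr₁pos, min_le_right _ _, hδ,
    hwzs.mono fun a ha => (key a ha).1, hwz0, fun a ha => (key a ha).2.1, ?_, ?_, ?_, ?_, ?_,
    fun a ha => (hhit a ha).1, fun a ha => ?_, hβs.mono fun a ha => (key a ha).1, hβ0,
    hαs.mono fun b hb => (hδsub hb).1, hαb₀,
    fun b hb => ⟨(hδsub hb).2, (hβα b (hδsub hb).1).2⟩,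
    fun a ha _ => (hαβ a (key a ha).1).2, fun b hb => hdα b (hδsub hb).1⟩
  · -- the `V`-disc `‖w‖ < 1/2` lies in the cap chart domain
    intro a ha w hw
    exact hOdom _ ((key a ha).2.2.1 w (mem_closedBall_zero_iff.2 hw.le))
  · -- the leaf meets `E` on `‖w‖ ≤ 1/2` exactly at `w = wz a`
    intro a ha w hw
    obtain ⟨-, -, -, hι', -, -, -, hun⟩ := key a ha
    refine ⟨fun hmem => ?_, ?_⟩
    · by_cases hwr : ‖w‖ < r₁
      · obtain ⟨hO', himp⟩ := hun w (hwr.trans_le hr₁r)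
        apply himp
        obtain ⟨σ, hσ⟩ := hmem
        change (D.capCoord (V a w)).1 = 0
        rw [← hσ, ← D.capInv_zero, D.capCoord_capInv _ (by simpa using D.ρ_pos)]
      · exfalso
        obtain ⟨x, hx⟩ := hι' w ⟨mem_closedBall_zero_iff.2 hw, fun h => hwr (mem_ball_zero_iff.1 h)⟩
        obtain ⟨σ, hσ⟩ := hmem
        exact D.ι_ne_capPt x σ (hx.trans hσ.symm)
    · rintro rfl
      rw [(hhit a ha).1]
      exact ⟨β a, rfl⟩
  · -- the `U`-disc `‖z‖ ≤ 2` stays in `ι(Σ ∖ p)`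
    intro a ha z hz
    exact (key a ha).2.2.2.2.1 z (mem_closedBall_zero_iff.2 hz)
  · -- holomorphy in the cap chart
    intro a ha
    obtain ⟨-, -, hO', -, -, haε, -⟩ := key a ha
    have haε' : ‖a‖ < ε := mem_ball_zero_iff.1 haε
    have hVa : ContMDiffOn 𝓘(ℝ, ℂ) (𝓡 4) ∞ (V a) (Metric.ball (0 : ℂ) 2⁻¹) := by
      have h : ContMDiffOn 𝓘(ℝ, ℂ) (𝓡 4) ∞ (Vf ∘ fun w : ℂ => (a, w)) univ :=
        hVfam.comp (contMDiff_iff_contDiff.2 (contDiff_prodMk_right a)).contMDiffOn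
          fun w _ => ⟨haε, mem_univ _⟩
      exact (contMDiffOn_univ.1 h).contMDiffOn
    exact helper_interceptChart_capHolo (fun y => D.JX y) D.capCoord D.capInv
      {q : ℂ × ℂ | ‖q.1‖ < D.ρ} D.isOpen_capDom D.contMDiffOn_capCoord
      (fun q hq => D.mfderiv_capInv_bijective q hq) (fun q hq => D.mfderiv_capCoord_comp q hq)
      (fun q hq v => D.JX_capInv q hq v) (V a) _ Metric.isOpen_ball hVa (hUV a haε').2.2
      fun w hw => hOdom _ (hO' w (mem_closedBall_zero_iff.2 (mem_ball_zero_iff.1 hw).le))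
  · -- the zero `wz a` of `t` is simple
    intro a ha hzero
    obtain ⟨-, hwzr, hO', -, -, haε, hD', -⟩ := key a ha
    have haε' : ‖a‖ < ε := mem_ball_zero_iff.1 haε
    apply hD'
    change fderiv ℝ (fun w => (D.capCoord (V a w)).1) (wz a) 1 = 0
    -- complex differentiability of `t` at `wz a`
    have hVa : ContMDiffOn 𝓘(ℝ, ℂ) (𝓡 4) ∞ (V a) (Metric.ball (0 : ℂ) 2⁻¹) := by
      have h : ContMDiffOn 𝓘(ℝ, ℂ) (𝓡 4) ∞ (Vf ∘ fun w : ℂ => (a, w)) univ :=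
        hVfam.comp (contMDiff_iff_contDiff.2 (contDiff_prodMk_right a)).contMDiffOn
          fun w _ => ⟨haε, mem_univ _⟩
      exact (contMDiffOn_univ.1 h).contMDiffOn
    have hhol := helper_interceptChart_capHolo (fun y => D.JX y) D.capCoord D.capInv
      {q : ℂ × ℂ | ‖q.1‖ < D.ρ} D.isOpen_capDom D.contMDiffOn_capCoord
      (fun q hq => D.mfderiv_capInv_bijective q hq) (fun q hq => D.mfderiv_capCoord_comp q hq)
      (fun q hq v => D.JX_capInv q hq v) (V a) _ Metric.isOpen_ball hVa (hUV a haε').2.2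
      fun w hw => hOdom _ (hO' w (mem_closedBall_zero_iff.2 (mem_ball_zero_iff.1 hw).le))
    have hwz2 : wz a ∈ Metric.ball (0 : ℂ) 2⁻¹ :=
      mem_ball_zero_iff.2 (hwzr.trans_le ((min_le_right _ _).trans (by norm_num)))
    have htd : DifferentiableAt ℂ (fun w => (D.capCoord (V a w)).1) (wz a) :=
      ((hhol _ hwz2).differentiableAt (Metric.isOpen_ball.mem_nhds hwz2)).fst
    rw [htd.fderiv_restrictScalars ℝ, ContinuousLinearMap.coe_restrictScalars', fderiv_apply_one_eq_deriv, hzero]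
  · -- `β a` is the `σ`-coordinate of the intersection point
    have h := congrArg Prod.snd (hhit a ha).2
    exact h.symm

end Summit.SmoothPoincare4.SmoothPoincare4.Theorems.WitnessCharge.PencilIncompleteness
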